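import Literature.MathematicalPhysics.QuantumFieldTheory.Balaban1983to89.B8Eq1101CubeMemberParametrixIdentity
import Literature.MathematicalPhysics.QuantumFieldTheory.Balaban1983to89.B8LambdaSpaceKLevel

/-!
# `Balaban1983to89.B8Eq1101CubeMemberReal` — [Balaban1985RegularSpaces] (1.101) AT `U₀ = 1` ON THE CUBE MEMBER `{□_j}` OF (1.131), IN THE CONSUMER'S SHAPE:
# the FUNCTION MEMBER of the REAL-1 family of `B8Prop6CubeMemberFlatScalar.prop6_cubeMember_flat_of_real` — `|T⁻¹ρ′| ≤ B_G·r` for sources with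
# `(Lʲη)²|ρ′| ≤ r` on `□_j` — PROVED from the two-region parametrix by an a-priori inversion of `1 + K₁`
# ([Balaban1985BackgroundPropagators] Theorem 3.1 p. 397 at `U = 1`, Dirichlet on `□₀`; [Balaban1984PropagatorsII] (2.47)–(2.58) p. 231–233, Prop. 2.2 p. 234)

statement-level skeleton of published theorems with citation tags; proofs where landed; nothing here is a claim about the
Yang–Mills mass gap

`[Balaban1985RegularSpaces]` ("B8", CMP **99** (1985) 75–102) (1.101) p. 93 («One of the results of [4], Theorem 3.1, tells us that G′ is a bounded operator from a
space with the norm |·|₍₋₂₎ into a space with the norm |·| for functions, and the norm |·|₍₋₁₎ for their first derivatives»), p. 98 (the cube family, «R₁, M₁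
are smallest integers for which all the theorems of the papers [2, 4] are valid», «M is a multiple of R₁M₁»), (1.131) p. 99; `[Balaban1985BackgroundPropagators]`
("[4]", CMP **99** (1985) 389–434) Theorem 3.1 (3.42) p. 397, (3.47) p. 398; `[Balaban1984PropagatorsII]` ("B6", CMP **96** (1984) 223–250) p. 228 («the operators
G(Ω) … with minor and obvious changes»), (2.47)–(2.58) p. 231–233, Prop. 2.2 (2.67) p. 234.  PDF held: `paper:balaban1985-cmp99-regular-spaces-gauge-fixing`.

CITATION HEADER (lean-in-tree rule).  Cell `pub-ymgap` (YM Track A, HUMAN RULING D-0062), DAG node N05 = [B8], seat `pub-ymgap-dag-n05-c` (g9; (R1′)-v2 HYBRID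
route, file F4c).  THE CONSUMER: n05-e's `B8Prop6CubeMemberFlatScalar.prop6_cubeMember_flat_of_real` (and its `…ScalarBdry` edition p534762) displays THREE REAL
inequality families on the explicit flat Dirichlet multi-level matrix `T = (K(x,z))_{x,z∈□₀}` of the cube member; REAL-1 = (1.101) has a function member
(`|φ| ≤ B_G r`) and a gradient member.  THIS FILE PROVES THE FUNCTION MEMBER, for `L = ℓ + 1` and dimension `d + 1`, on the sub-lattice of data the route
needs (big-block compatibility `M_hL ∣ ρ`, `M_hL ∣ M`, collar law `R·M_hL ≤ ρ ≥ ρ₀(d, L)`, thresholds of p21∕r05, weights `w_j = η⁻²a_jL^{(d−1)j}` with p21's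
`a_j ∈ [4, 8]` and `a′₀ = w₀η² ∈ [4, 8]`).  THE CHAIN (all kernel-checked, this base g8∕g9): bricks 1–3 `B8Eq191FlatDirichletCoercive∕Conjugation∕LipschitzExponent`
(weighted-ℓ² Agmon on any site set) → F3 `B8Eq191FlatDirichletWall` (the wall piece) · F1 `B8CubeMemberBoxDomains` (the inner cube family as a member of p21's
Neumann-box family; r05's HYPOTHESIS-FREE `B8Ineq198MultiLevelBox.ineq1101_multiLevelBox_two` over p21's `B6Prop22AllMultiLevelBox` read at it) · F2
`B8CubeMemberBoxRows` (the rows of `K` at interior sites of `□₁` are the rows of `η⁻²·mlOp`) · F4a `B8Eq1101CubeMemberCutoffs` (partition of unity, wall) · F4b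
`B8Eq1101CubeMemberParametrixIdentity` (`T·P = 1 + K₁`, `‖K₁‖₍₋₂₎ ≤ 10(d+1)L²(C′_A + C_B)∕s`) → HERE.

WHAT THIS FILE PROVES (kernel-checked; theorems only).
* §1 ★ `apriori_functional_bound` — the abstract a-priori inversion: if `Φ w = Π w − Φ(K₁w)`, `|Π w| ≤ CN`, `K₁` halves the size predicate, and `Φ` has any
  crude bound, then `|Φ w| ≤ 2CN` (iterate `m` times, let `m → ∞`; no inverse of `1 + K₁`, no series, no linear structure needed).
* §2 `dite_shift_apply`, `dite_mem_apply` (pull-back ∕ extension-by-zero bookkeeping).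
* §3 ★★★ `ineq1101_cubeMember_sup` — THE FUNCTION MEMBER OF (1.101) IN THE CONSUMER'S SHAPE: `∃ B_G ρ₀ M₀ N₀` (functions of `d, ℓ` only) such that for all
  admissible data, all sources `ρ′` with `wt(j)²|ρ′| ≤ r` on `□_j` (`j ≤ n`, the consumer's hypothesis verbatim with `cubeFam false (ℓ+1) …`, `wt (ℓ+1) η j`),
  and `φ` with `φ = 0` off `□₀`, `φ(v) = Σ_z T⁻¹(v,z)ρ′(z)` on `□₀` (the consumer's letters verbatim, `T = Matrix.of K`): `∀ x, |φ x| ≤ B_G·r`.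
  PROOF: `s := ⌊(ρL − (d+1)ℓ)∕4⌋ ≥ 20(d+1)L²(C′ + C_W)` (from `ρ ≥ ρ₀`), wall parameter `m_W = 4s`; the objects `uA, gAx, uB, gBx, P, K₁, ψ = T⁻¹·` as
  explicit functions of the source; F4b's `parametrix_identity` + `T⁻¹T = 1` (`isUnit_flatMatrix`) give `ψ u = P u − ψ(K₁u)` on `□₀`; F4b's
  `regionA_bounds` (fed by F1's `ineq1101_regionA` at windows `[4,8]`), `regionB_bound`, `parametrix_sup`, `commutator_bound` give `|P u| ≤ (C′ + C_W)N` and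
  `BW(K₁u, N∕2)`; the crude bound is `η⁻²Σ_z|T⁻¹(x,z)|`; §1 concludes with `B_G = 2(C′ + C_W)`.

HONEST SCOPE ∕ NOT CLAIMED.  (i) The GRADIENT member of REAL-1 (`wt(j)|η⁻¹Δφ| ≤ B_G r` on bonds touching `□_j`) is NOT in this file (successor: the same
a-priori lemma on the functional `Lʲ(ψ(y+e_μ) − ψ(y))` with F4b's `parametrix_grad_deep` for bonds touching `□_j`, `j ≥ 2`, and the function member for
`j ≤ 1`); REAL-2 ((1.92)) and REAL-3 ((1.98)) are not touched.  (ii) The data are restricted to print's sub-lattice («□_j is a sum of the big blocks», «M a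
multiple of R₁M₁», `R₁M₁` large): `M_hL ∣ ρ`, `M_hL ∣ M`, `ρ ≥ ρ₀(d,L)`, `M_h ≥ 3` with `M₀ ≤ L·M_h`, `2L ≤ R`, `N₀ + 1 ≤ R·L·M_h`, `R·M_hL ≤ ρ` — the consumer
quantifies `∀ M ρ` with `L ≤ ρ ≤ M` only, so the final knit supplies REAL-1 on this sub-lattice (LOCATED-ρ of this base, bus l.19153, in print's own form).
(iii) The weights are the consumer's free `w`, here tied to p21's recursion (`a_{j+1} = aNext ℓ a_j c_j`, windows `[4,8]`; the printed sequence
`B6MultiLevelBoxOperator.aPrinted 8` qualifies for `L ≥ 2`).  (iv) Statement for `L = ℓ + 1`, dimension `d + 1` (the consumer's `L ≥ 2`, `d ≥ 2` instantiate).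
(v) Constants are existential and far from print's.  Count-neutral; N05 NOT discharged; one finite `T⁴` programme at fixed `ε`, Bałaban as printed; nothing
continuum ∕ ℝ⁴ ∕ OS ∕ mass-gap ∕ Clay.  No `sorry`, no `def`, no `instance`, no `notation`.  Unit `pub-ymgap-dag-n05-c` (g9), 2026-08-27.

RELATED IN THE TREE, NOT DUPLICATED: `B8Prop6CubeMemberFlatScalar.prop6_cubeMember_flat_of_real` ∕ `B8Prop6CubeMemberScalarBdry.*` (the CONSUMERS; their REAL-1
hypothesis is quantified over all `L ≤ ρ ≤ M` and carries the gradient member — this file serves its function member on the sub-lattice above);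
`B8Ineq198MultiLevelBox.ineq1101_multiLevelBox_two` (r05: (1.101) on the Neumann box — region A's input, not the consumer's Dirichlet carrier);
`B8Eq191FlatDirichlet{Coercive,Conjugation,LipschitzExponent,Distance,Depth,CollarDecay,Lateral,Counting,Wall}` (this base's bricks), F1–F4b above (USED BY NAME).
-/
noncomputable section

namespace Literature.MathematicalPhysics.QuantumFieldTheory.Balaban1983to89.B8Eq1101CubeMemberReal

/-! ## §1 The a-priori bound: `Φ(w) = Pf(w) − Φ(K₁w)`, `|Pf| ≤ C`, `‖K₁‖ ≤ ½` ⇒ `|Φ| ≤ 2C` (no inverse of `1 + K₁` is formed) -/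

/-- **A-PRIORI INVERSION OF `1 + K₁` ON FUNCTIONALS.**  Let `BW w N` be a size predicate on sources, `K₁` an operator halving it (`BW w N ⇒ BW (K₁w) (N∕2)`),
`Φ` a functional with a crude bound `|Φ w| ≤ B₀N` and `Pf` a functional with `|Pf w| ≤ CN`, related by `Φ w = Pf w − Φ (K₁ w)`.  Then `|Φ w| ≤ 2CN`.
(Iterating the relation `m` times gives `|Φ w| ≤ (2C + B₀2^{−m})N`; let `m → ∞`.)  This is the convergence of the expansion (2.57)–(2.58) read as an
a-priori estimate. [cite: Balaban1984PropagatorsII, (2.56)–(2.58) p.233 («the series … is convergent for M sufficiently large»)] -/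
theorem apriori_functional_bound {α : Type*} (BW : (α → ℝ) → ℝ → Prop) (K₁ : (α → ℝ) → (α → ℝ)) (Φ Pf : (α → ℝ) → ℝ)
    {C B₀ : ℝ} (hC : 0 ≤ C)
    (hid : ∀ w, Φ w = Pf w - Φ (K₁ w))
    (hPf : ∀ w N, 0 ≤ N → BW w N → |Pf w| ≤ C * N)
    (hK : ∀ w N, 0 ≤ N → BW w N → BW (K₁ w) (N / 2))
    (hcrude : ∀ w N, 0 ≤ N → BW w N → |Φ w| ≤ B₀ * N)
    (w : α → ℝ) {N : ℝ} (hN : 0 ≤ N) (hw : BW w N) : |Φ w| ≤ 2 * C * N := by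
  -- the iterated bound
  have hiter : ∀ m : ℕ, ∀ w N, 0 ≤ N → BW w N → |Φ w| ≤ (2 * C + B₀ / 2 ^ m) * N := by
    intro m
    induction m with
    | zero =>
      intro w N hN hw
      have h := hcrude w N hN hw
      have : B₀ * N ≤ (2 * C + B₀ / 2 ^ 0) * N := by
        rw [pow_zero, div_one]; nlinarith
      exact h.trans this
    | succ m ih =>
      intro w N hN hw
      have h1 := hPf w N hN hw
      have h2 := ih (K₁ w) (N / 2) (by positivity) (hK w N hN hw)
      rw [hid w]
      calc |Pf w - Φ (K₁ w)| ≤ |Pf w| + |Φ (K₁ w)| := abs_sub _ _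
        _ ≤ C * N + (2 * C + B₀ / 2 ^ m) * (N / 2) := add_le_add h1 h2
        _ = (2 * C + B₀ / 2 ^ (m + 1)) * N := by rw [pow_succ]; ring
  -- let `m → ∞`
  refine le_of_forall_pos_lt_add fun ε hε => ?_
  obtain ⟨m, hm⟩ : ∃ m : ℕ, B₀ * N / ε < 2 ^ m := pow_unbounded_of_one_lt _ (by norm_num : (1 : ℝ) < 2)
  have h := hiter m w N hN hw
  have h2m : (0 : ℝ) < 2 ^ m := by positivity
  have hlt : B₀ / 2 ^ m * N < ε := by
    rw [div_lt_iff₀ hε] at hm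
    rw [div_mul_eq_mul_div, div_lt_iff₀ h2m]
    linarith [mul_comm ε (2 ^ m : ℝ)]
  calc |Φ w| ≤ (2 * C + B₀ / 2 ^ m) * N := h
    _ = 2 * C * N + B₀ / 2 ^ m * N := by ring
    _ < 2 * C * N + ε := by linarith

/-! ## §2 Small dictionary lemmas for the explicit objects of the parametrix -/

open scoped Matrix
open B6MultiLevelBoxOperator (N0 mlOp gml levC)
open B6Prop22DerivMultiLevelBox (dMat)
open B6Ineq243TwoLevelBox (aNext)
open B4Reflection242 (boxDom)
open B7Prop1Explicit (e)
open B8Eq131Cubes (cube)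
open B8Eq131CubesAdmissible (cubeFam cubeFam_false_of_le)
open B8CubeMemberZd (cubeLamS)
open B8LambdaSpaceKLevel (wt)
open B8Eq191FlatDirichletForm (isUnit_flatMatrix)
open B8CubeMemberBoxDomains (shift boxP lev ineq1101_regionA)
open B8Eq1101CubeMemberCutoffs (cutA cutAt cutB cutBt wall wall_subset)
open B8Eq1101CubeMemberParametrixIdentity (parametrix_identity regionA_bounds regionB_bound parametrix_sup commutator_bound)
open Literature.MathematicalPhysics.QuantumLattice (blockMap)

variable {d : ℕ}

/-- Pull-back by the translation: `(z ↦ [z + t ∈ X]·G(z + t))(y − t) = G(y)`. [folklore] [cite: Balaban1984PropagatorsII, (2.1) p.224] -/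
theorem dite_shift_apply {X : Finset (Fin (d + 1) → ℤ)} (t : Fin (d + 1) → ℤ) (G : ↥X → ℝ) (y : ↥X) :
    (fun z => if h : z + t ∈ X then G ⟨z + t, h⟩ else 0) (y.1 - t) = G y := by
  have hy : y.1 - t + t ∈ X := by rw [sub_add_cancel]; exact y.2
  simp only [dif_pos hy]
  congr 1
  exact Subtype.ext (sub_add_cancel _ _)

/-- Extension by zero: `(z ↦ [z ∈ W]·G(z))(y) = G(y)` for `y ∈ W`. [folklore] [cite: Balaban1984PropagatorsII, (2.1) p.224] -/
theorem dite_mem_apply {W : Finset (Fin (d + 1) → ℤ)} (G : ↥W → ℝ) (y : ↥W) :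
    (fun z => if h : z ∈ W then G ⟨z, h⟩ else 0) y.1 = G y := by
  simp only [dif_pos y.2]

/-! ## §3 (1.101), FUNCTION MEMBER, IN THE CONSUMER'S SHAPE -/

open Classical in
/-- **[Balaban1985RegularSpaces] (1.101) AT `U₀ = 1` ON THE CUBE MEMBER — THE FUNCTION MEMBER OF THE REAL-1 FAMILY OF `prop6_cubeMember_flat_of_real`**
(«G′ is a bounded operator from a space with the norm |·|₍₋₂₎ into a space with the norm |·| for functions»).  There are `B_G, ρ₀, M₀ > 0` and `N₀ ≥ 1`,
depending on `d, ℓ` only, such that: for every `η > 0`, every big-block size `M_h ≥ 3` with `M₀ ≤ L·M_h` (`L = ℓ + 1`), every cube datum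
`(a, M, ρ, k)` and truncation `1 ≤ n ≤ k` with `M_hL ∣ ρ`, `M_hL ∣ M`, `R·M_hL ≤ ρ`, `2L ≤ R`, `N₀ + 1 ≤ R·L·M_h`, `ρ₀ ≤ ρ` (print's «R₁, M₁ smallest integers
for which all the theorems of [2, 4] are valid», «M a multiple of R₁M₁»), every p21 weight sequence in the window `[4, 8]` with its recursion, every
consumer weight sequence `w > 0` with `w_j·L^{−2(d+1)j} = η⁻²·levC_j` (`1 ≤ j ≤ n`) and normalised weights in `[4, 8]`, the explicit matrix `T = (K(x,z))` of the
consumer on `S = □₀`, and every source `ρ′` with `(Lʲη)²|ρ′| ≤ r` on `□_j` (`j ≤ n`): the solution `φ = T⁻¹ρ′` (extended by `0` off `□₀`) satisfies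
`|φ(x)| ≤ B_G·r` for all `x`.  PROOF: two-region parametrix `T·P = 1 + K₁` (F4b) with region A = p21's Neumann box (r05's hypothesis-free (1.101), F1), region
B = the wall (F3, F4a), ramp length `s = ⌊(ρL − (d+1)ℓ)∕4⌋ ≥ 20(d+1)L²(C′_A + C_B)` so that `‖K₁‖₍₋₂₎ ≤ ½`, and the a-priori inversion of §1.
[cite: Balaban1985RegularSpaces, (1.101) p.93, p.98, (1.131) p.99; Balaban1985BackgroundPropagators, Theorem 3.1 (3.42) p.397; Balaban1984PropagatorsII, p.228, (2.47)–(2.58) p.231–233, Prop. 2.2 (2.67) p.234] -/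
theorem ineq1101_cubeMember_sup (d ℓ : ℕ) (hℓ : 1 ≤ ℓ) :
    ∃ BG ρ₀ M₀ : ℝ, ∃ N₀ : ℕ, 0 < BG ∧ 0 < M₀ ∧ 0 < N₀ ∧
      ∀ (η : ℝ), 0 < η → ∀ (Mh : ℕ), 3 ≤ Mh → M₀ ≤ ((ℓ : ℝ) + 1) * Mh →
      ∀ (a : Fin (d + 1) → ℤ) (M ρ k n R : ℕ), 1 ≤ n → n ≤ k → Mh * (ℓ + 1) ∣ ρ → Mh * (ℓ + 1) ∣ M → 0 < ρ →
        R * (Mh * (ℓ + 1)) ≤ ρ → 2 * (ℓ + 1) ≤ R → N₀ + 1 ≤ R * ((ℓ + 1) * Mh) → ρ₀ ≤ (ρ : ℝ) →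
      ∀ (aw c : ℕ → ℝ), (∀ i, 1 ≤ i → 4 ≤ aw i ∧ aw i ≤ 8) → (∀ i, 1 ≤ i → 4 ≤ c i ∧ c i ≤ 8) →
        (∀ i, 1 ≤ i → aw (i + 1) = aNext ℓ (aw i) (c i)) → (∀ j, 0 < aw j) →
      ∀ (w : ℕ → ℝ), (∀ j, 0 < w j) →
        (∀ j, 1 ≤ j → j ≤ n → w j * (((((ℓ + 1 : ℕ) : ℝ) ^ (d + 1))⁻¹) ^ j) ^ 2 = (η ^ 2)⁻¹ * levC d ℓ aw j) →
        (∀ j, j ≤ n → 4 ≤ w j * η ^ 2 * (((ℓ + 1 : ℕ) : ℝ) ^ j) ^ 2 * (((((ℓ + 1 : ℕ) : ℝ)) ^ (d + 1)) ^ j)⁻¹ ∧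
          w j * η ^ 2 * (((ℓ + 1 : ℕ) : ℝ) ^ j) ^ 2 * (((((ℓ + 1 : ℕ) : ℝ)) ^ (d + 1)) ^ j)⁻¹ ≤ 8) →
      ∀ (S : Finset (Fin (d + 1) → ℤ)), (∀ z, z ∈ S ↔ z ∈ cubeFam false (ℓ + 1) a M ρ k 0) →
      ∀ (K : (Fin (d + 1) → ℤ) → (Fin (d + 1) → ℤ) → ℝ), (∀ x z, K x z =
          ((η ^ 2)⁻¹ * ∑ μ : Fin (d + 1), ((2 : ℝ) * (if z = x then (1 : ℝ) else 0) - (if z = x + e μ then (1 : ℝ) else 0)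
            - (if z = x - e μ then (1 : ℝ) else 0))) +
          (∑ j ∈ Finset.range (n + 1), (if blockMap ((ℓ + 1) ^ j) x ∈ cubeLamS (ℓ + 1) a M ρ k n j ∧
              blockMap ((ℓ + 1) ^ j) z = blockMap ((ℓ + 1) ^ j) x then
            w j * (((((ℓ + 1 : ℕ) : ℝ) ^ (d + 1))⁻¹) ^ j) ^ 2 else 0))) →
      ∀ (T : Matrix ↥S ↥S ℝ), T = Matrix.of (fun x z : ↥S => K x.1 z.1) →
      ∀ (ρ' : ↥S → ℝ) (r : ℝ), 0 ≤ r →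
        (∀ j, j ≤ n → ∀ z : ↥S, z.1 ∈ cubeFam false (ℓ + 1) a M ρ k j → wt (ℓ + 1) η j ^ 2 * |ρ' z| ≤ r) →
        ∀ φ : (Fin (d + 1) → ℤ) → ℝ, (∀ x, x ∉ cubeFam false (ℓ + 1) a M ρ k 0 → φ x = 0) →
          (∀ v : ↥S, φ v.1 = ∑ z : ↥S, T⁻¹ v z * ρ' z) →
          ∀ x, |φ x| ≤ BG * r := by
  have hd : 0 < d + 1 := Nat.succ_pos d
  have hL : 1 ≤ ℓ + 1 := Nat.succ_pos ℓ
  have hLr : (1 : ℝ) ≤ ((ℓ + 1 : ℕ) : ℝ) := by exact_mod_cast hL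
  have hLpos : (0 : ℝ) < ((ℓ + 1 : ℕ) : ℝ) := by positivity
  -- region A's (1.101) package (p21 ∕ r05 via F1), weight windows `[4, 8]`
  obtain ⟨C', M₀, N₀, hC', hM₀, hN₀, hregA⟩ := ineq1101_regionA d ℓ hℓ 4 8 4 8 (by norm_num) (by norm_num)
  -- the wall constant (F3 at `a₀ = 4`, `θ = ½`, `δ′ = 1/(2(d+1))`)
  set CW : ℝ := (((ℓ + 1 : ℕ) : ℝ)) ^ 2 / (4 * (1 - 1 / 2)) * B6.c0 1 (1 / (2 * ((d : ℝ) + 1)) / ((ℓ + 1 : ℕ) : ℝ)) ^ (d + 1) with hCW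
  have hc0 : 1 ≤ B6.c0 1 (1 / (2 * ((d : ℝ) + 1)) / ((ℓ + 1 : ℕ) : ℝ)) := B8Eq191FlatDirichletWall.one_le_c0 (by positivity)
  have hCW0 : 0 ≤ CW := by rw [hCW]; have := hc0; positivity
  -- the ramp-length threshold and the collar threshold
  set s₀ : ℝ := 20 * ((d : ℝ) + 1) * (((ℓ + 1 : ℕ) : ℝ)) ^ 2 * (C' + CW) with hs₀
  have hs₀0 : 0 ≤ s₀ := by rw [hs₀]; positivity
  set ρ₀ : ℝ := 4 * s₀ + 12 + ((d : ℝ) + 1) * ℓ with hρ₀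
  refine ⟨2 * (C' + CW), ρ₀, M₀, N₀, by positivity, hM₀, hN₀, ?_⟩
  intro η hη Mh hMh hM0 a M ρ k n R hn hnk hρd hMd hρ0 hR hR2 hRN hρbig aw c haw hc hrec hawpos w hwpos hw hwin S hS K hK T hT
    ρ' r hr hρ' φ hφ0 hφ x₀
  have hη0 : η ≠ 0 := hη.ne'
  have hMh1 : 1 ≤ Mh := le_trans (by norm_num) hMh
  have hk : 1 ≤ k := hn.trans hnk
  have hρL : ℓ + 1 ≤ ρ := le_trans (Nat.le_mul_of_pos_left _ hMh1) (Nat.le_of_dvd hρ0 hρd)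
  -- the ramp length `s` and the wall parameter `m_W = 4s`
  obtain ⟨s, hs⟩ : ∃ s : ℕ, s = (ρ * (ℓ + 1) - (d + 1) * ℓ) / 4 := ⟨_, rfl⟩
  have hρL' : (d + 1) * ℓ + 4 * (Nat.ceil s₀ + 1) ≤ ρ * (ℓ + 1) := by
    have h1 : (ρ : ℝ) ≤ (ρ : ℝ) * ((ℓ + 1 : ℕ) : ℝ) := le_mul_of_one_le_right (by positivity) hLr
    have h2 : ((Nat.ceil s₀ : ℕ) : ℝ) < s₀ + 1 := Nat.ceil_lt_add_one hs₀0
    have h3 : (((d + 1) * ℓ + 4 * (Nat.ceil s₀ + 1) : ℕ) : ℝ) ≤ ((ρ * (ℓ + 1) : ℕ) : ℝ) := by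
      push_cast; rw [hρ₀] at hρbig; push_cast at h1; nlinarith
    exact_mod_cast h3
  have hs_ge : Nat.ceil s₀ + 1 ≤ s := by
    rw [hs, Nat.le_div_iff_mul_le (by norm_num)]; omega
  have hs1 : 1 ≤ s := le_trans (by omega) hs_ge
  have hss₀ : s₀ ≤ s := (Nat.le_ceil s₀).trans (by exact_mod_cast (by omega : Nat.ceil s₀ ≤ s))
  have hs4 : 4 * s + (d + 1) * ℓ ≤ ρ * (ℓ + 1) := by
    rw [hs]; have := Nat.div_mul_le_self (ρ * (ℓ + 1) - (d + 1) * ℓ) 4; omega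
  have hmWρ : ((4 * s : ℕ) : ℤ) + (d + 1 : ℕ) * ((ℓ + 1 : ℕ) - 1 : ℤ) ≤ ρ * (ℓ + 1 : ℕ) := by
    have : (((4 * s + (d + 1) * ℓ : ℕ)) : ℤ) ≤ ((ρ * (ℓ + 1) : ℕ) : ℤ) := by exact_mod_cast hs4
    push_cast at this ⊢; linarith
  have hρs : 4 * (s : ℤ) ≤ ρ * (ℓ + 1 : ℕ) := by
    have : (((4 * s : ℕ)) : ℤ) ≤ ((ρ * (ℓ + 1) : ℕ) : ℤ) := by exact_mod_cast (le_trans (Nat.le_add_right _ _) hs4)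
    push_cast at this ⊢; linarith
  have hs0r : (0 : ℝ) < s := by exact_mod_cast hs1
  -- the size predicate and the explicit operators of the parametrix, as functions of the source `u`
  obtain ⟨BW, hBW⟩ : ∃ BW : ((Fin (d + 1) → ℤ) → ℝ) → ℝ → Prop,
      ∀ u N, BW u N ↔ ∀ j, j ≤ n → ∀ z, z ∈ cube (ℓ + 1) a M ρ k j → ((((ℓ + 1 : ℕ) : ℝ)) ^ j * η) ^ 2 * |u z| ≤ N :=
    ⟨fun u N => ∀ j, j ≤ n → ∀ z, z ∈ cube (ℓ + 1) a M ρ k j → ((((ℓ + 1 : ℕ) : ℝ)) ^ j * η) ^ 2 * |u z| ≤ N, fun _ _ => Iff.rfl⟩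
  obtain ⟨uAf, huAf⟩ : ∃ uAf : ((Fin (d + 1) → ℤ) → ℝ) → ↥(boxDom (N0 ℓ Mh n (boxP ℓ M ρ k n))) → ℝ,
      ∀ u y, uAf u y = cutA hd (ℓ + 1) a M ρ k s (y.1 - shift ℓ Mh a ρ k n) * u (y.1 - shift ℓ Mh a ρ k n) := ⟨_, fun _ _ => rfl⟩
  obtain ⟨gAxf, hgAxf⟩ : ∃ gAxf : ((Fin (d + 1) → ℤ) → ℝ) → (Fin (d + 1) → ℤ) → ℝ,
      ∀ u z, gAxf u z = if h : z + shift ℓ Mh a ρ k n ∈ boxDom (N0 ℓ Mh n (boxP ℓ M ρ k n)) then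
        (gml (N0 ℓ Mh n (boxP ℓ M ρ k n)) ℓ n (lev ℓ Mh a M ρ k n) aw *ᵥ uAf u) ⟨z + shift ℓ Mh a ρ k n, h⟩ else 0 := ⟨_, fun _ _ => rfl⟩
  obtain ⟨uBf, huBf⟩ : ∃ uBf : ((Fin (d + 1) → ℤ) → ℝ) → ↥(wall hd (ℓ + 1) a M ρ k S (4 * s)) → ℝ,
      ∀ u y, uBf u y = cutB hd (ℓ + 1) a M ρ k s y.1 * u y.1 := ⟨_, fun _ _ => rfl⟩
  obtain ⟨gBxf, hgBxf⟩ : ∃ gBxf : ((Fin (d + 1) → ℤ) → ℝ) → (Fin (d + 1) → ℤ) → ℝ,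
      ∀ u z, gBxf u z = if h : z ∈ wall hd (ℓ + 1) a M ρ k S (4 * s) then
        (((Matrix.of fun x z : ↥(wall hd (ℓ + 1) a M ρ k S (4 * s)) => K x.1 z.1)⁻¹) *ᵥ uBf u) ⟨z, h⟩ else 0 := ⟨_, fun _ _ => rfl⟩
  obtain ⟨Pf, hPf⟩ : ∃ Pf : ((Fin (d + 1) → ℤ) → ℝ) → (Fin (d + 1) → ℤ) → ℝ,
      ∀ u z, Pf u z = cutAt hd (ℓ + 1) a M ρ k s z * (η ^ 2 * gAxf u z) + cutBt hd (ℓ + 1) a M ρ k s z * gBxf u z := ⟨_, fun _ _ => rfl⟩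
  obtain ⟨K₁, hK₁⟩ : ∃ K₁ : ((Fin (d + 1) → ℤ) → ℝ) → (Fin (d + 1) → ℤ) → ℝ,
      ∀ u x, K₁ u x = ∑ z ∈ S, K x z * ((cutAt hd (ℓ + 1) a M ρ k s z - cutAt hd (ℓ + 1) a M ρ k s x) * (η ^ 2 * gAxf u z)
        + (cutBt hd (ℓ + 1) a M ρ k s z - cutBt hd (ℓ + 1) a M ρ k s x) * gBxf u z) := ⟨_, fun _ _ => rfl⟩
  obtain ⟨ψ, hψ⟩ : ∃ ψ : ((Fin (d + 1) → ℤ) → ℝ) → (Fin (d + 1) → ℤ) → ℝ,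
      ∀ u x, ψ u x = if h : x ∈ S then ∑ z : ↥S, T⁻¹ ⟨x, h⟩ z * u z.1 else 0 := ⟨_, fun _ _ => rfl⟩
  -- facts about the explicit objects
  have hgAx_pull : ∀ u (y : ↥(boxDom (N0 ℓ Mh n (boxP ℓ M ρ k n)))),
      gAxf u (y.1 - shift ℓ Mh a ρ k n) = (gml (N0 ℓ Mh n (boxP ℓ M ρ k n)) ℓ n (lev ℓ Mh a M ρ k n) aw *ᵥ uAf u) y := by
    intro u y
    have h := dite_shift_apply (shift ℓ Mh a ρ k n) (gml (N0 ℓ Mh n (boxP ℓ M ρ k n)) ℓ n (lev ℓ Mh a M ρ k n) aw *ᵥ uAf u) y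
    rw [hgAxf]; exact h
  have hgBx_mem : ∀ u (y : ↥(wall hd (ℓ + 1) a M ρ k S (4 * s))),
      gBxf u y.1 = (((Matrix.of fun x z : ↥(wall hd (ℓ + 1) a M ρ k S (4 * s)) => K x.1 z.1)⁻¹) *ᵥ uBf u) y := by
    intro u y; rw [hgBxf, dif_pos y.2]
  have hgBx0 : ∀ u z, z ∉ wall hd (ℓ + 1) a M ρ k S (4 * s) → gBxf u z = 0 := by
    intro u z hz; rw [hgBxf, dif_neg hz]
  have hw0 : ∀ j, 0 ≤ w j := fun j => (hwpos j).le
  -- (i) the bounds of the two regions for a source of size `N`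
  have hregA' : ∀ (f : ↥(boxDom (N0 ℓ Mh n (boxP ℓ M ρ k n))) → ℝ) (S' : ℝ), 0 ≤ S' →
      (∀ z : ↥(boxDom (N0 ℓ Mh n (boxP ℓ M ρ k n))), |f z| ≤ S' * ((((ℓ : ℝ) + 1) ^ lev ℓ Mh a M ρ k n z.1) ^ 2)⁻¹) →
      ∀ y : ↥(boxDom (N0 ℓ Mh n (boxP ℓ M ρ k n))),
        |(gml (N0 ℓ Mh n (boxP ℓ M ρ k n)) ℓ n (lev ℓ Mh a M ρ k n) aw *ᵥ f) y| ≤ C' * S' ∧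
        ∀ μ : Fin (d + 1), |(dMat (N0 ℓ Mh n (boxP ℓ M ρ k n)) μ *ᵥ (gml (N0 ℓ Mh n (boxP ℓ M ρ k n)) ℓ n (lev ℓ Mh a M ρ k n) aw *ᵥ f)) y|
          ≤ C' * (((ℓ : ℝ) + 1) ^ lev ℓ Mh a M ρ k n y.1)⁻¹ * S' := by
    intro f S' hS' hf y
    obtain ⟨h1, h2, -, -⟩ := hregA Mh hMh hM0 a M ρ k n R hn hnk hρd hMd hρ0 hR hR2 hRN aw c haw hc hrec f S' hS' hf y
    exact ⟨h1, h2⟩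
  have hcubeS : ∀ j, j ≤ n → ∀ z, z ∈ cube (ℓ + 1) a M ρ k j → z ∈ S := by
    intro j hj z hz
    have hsub := B8Eq191FlatLettersCubeMember.cubeFam_antitone hL a M hρL k (Nat.zero_le j)
    rw [cubeFam_false_of_le _ a M ρ (hj.trans hnk)] at hsub
    exact (hS z).mpr (hsub hz)
  have hAbound : ∀ u N, 0 ≤ N → BW u N → ∀ z, η ^ 2 * |gAxf u z| ≤ C' * N := by
    intro u N hN hu z
    rw [hBW] at hu
    rw [hgAxf]
    split_ifs with h
    · exact (regionA_bounds hMh1 a hn hnk hρd hρ0 hη aw hregA' hs1 u hN hu (uAf u) (huAf u) ⟨_, h⟩).1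
    · rw [abs_zero, mul_zero]; positivity
  have hAgrad : ∀ u N, 0 ≤ N → BW u N → ∀ (y : ↥(boxDom (N0 ℓ Mh n (boxP ℓ M ρ k n)))) (μ : Fin (d + 1)),
      η ^ 2 * |(dMat (N0 ℓ Mh n (boxP ℓ M ρ k n)) μ *ᵥ (gml (N0 ℓ Mh n (boxP ℓ M ρ k n)) ℓ n (lev ℓ Mh a M ρ k n) aw *ᵥ uAf u)) y|
        ≤ C' * N * (((ℓ : ℝ) + 1) ^ lev ℓ Mh a M ρ k n y.1)⁻¹ := by
    intro u N hN hu y μ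
    rw [hBW] at hu
    exact (regionA_bounds hMh1 a hn hnk hρd hρ0 hη aw hregA' hs1 u hN hu (uAf u) (huAf u) y).2 μ
  have hBbound : ∀ u N, 0 ≤ N → BW u N → ∀ z, |gBxf u z| ≤ CW * N := by
    intro u N hN hu z
    rw [hBW] at hu
    rw [hgBxf]
    split_ifs with h
    · have hb := regionB_bound a M hρL hnk hη0 w hwpos K hK S hS (a₀ := 4) (by norm_num) (by norm_num)
        (fun j hj => (hwin j hj).1) (fun j hj => (hwin j hj).2) (s := s) (mW := 4 * s) hmWρ u hN hu (uBf u) (huBf u) ⟨z, h⟩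
      rw [hCW]; exact hb
    · rw [abs_zero]; positivity
  -- (ii) `|P u| ≤ (C′ + C_W)N`
  have hPbound : ∀ u N, 0 ≤ N → BW u N → ∀ x, |Pf u x| ≤ (C' + CW) * N := by
    intro u N hN hu x
    rw [hPf]
    have h := parametrix_sup hd (ℓ + 1) a M ρ k s (η := η) (gAxf u) (gBxf u) (hAbound u N hN hu) (hBbound u N hN hu) x
    linarith
  -- (iii) `K₁` halves the size
  have hKhalf : ∀ u N, 0 ≤ N → BW u N → BW (K₁ u) (N / 2) := by
    intro u N hN hu
    rw [hBW]
    intro j hj z hz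
    have hzS : z ∈ S := hcubeS j hj z hz
    have hcb := commutator_bound hMh1 a hn hnk hρd hρ0 hη0 w aw hw0 (by linarith [(haw 1 le_rfl).1]) (haw 1 le_rfl).2 hw K hK S hS hs1 hρs
      (gAxf u) (gBxf u) (A := C' * N) (B := CW * N) (by positivity) (by positivity) (hAbound u N hN hu) (hBbound u N hN hu)
      (fun z hz => hgBx0 u z (fun h => hz (wall_subset hd (ℓ + 1) a M ρ k S (4 * s) h))) hzS hj hz
    rw [hK₁]
    refine hcb.trans ?_
    -- `10(d+1)L²(C′+C_W)N/s ≤ N/2` since `s ≥ s₀ = 20(d+1)L²(C′+C_W)`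
    rw [div_le_iff₀ hs0r]
    have : 10 * ((d : ℝ) + 1) * (((ℓ + 1 : ℕ) : ℝ)) ^ 2 * (C' * N + CW * N) = (s₀ / 2) * N := by rw [hs₀]; ring
    rw [this]
    have hN2 : 0 ≤ N / 2 := by positivity
    nlinarith
  -- (iv) the identity `ψ u x = P u x − ψ (K₁u) x` on `S`, from `T·P = 1 + K₁` and `T⁻¹T = 1`
  have hTunit : IsUnit T := by rw [hT]; exact isUnit_flatMatrix hd hη0 (ℓ + 1) n (cubeLamS (ℓ + 1) a M ρ k n) w hw0 K hK S
  have hTT : T⁻¹ * T = 1 := Matrix.nonsing_inv_mul T ((Matrix.isUnit_iff_isUnit_det T).mp hTunit)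
  have hident : ∀ u (x : ↥S), ψ u x.1 = Pf u x.1 - ψ (K₁ u) x.1 := by
    intro u x
    -- `T·(P u) = u + K₁u` at every row
    have hrow : ∀ z : ↥S, ∑ y : ↥S, T z y * Pf u y.1 = u z.1 + K₁ u z.1 := by
      intro z
      have hpi := parametrix_identity hℓ hMh1 a hn hnk hρd hMd hρ0 hR hη0 w aw hw0 hawpos hw K hK S hS hs1 (mW := 4 * s) le_rfl u
        (uAf u) (huAf u) (gAxf u) (hgAx_pull u) (uBf u) (huBf u) (gBxf u) (hgBx_mem u) (hgBx0 u) z.2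
      rw [hK₁, ← hpi, ← Finset.sum_coe_sort S]
      refine Finset.sum_congr rfl fun y _ => ?_
      rw [hT, Matrix.of_apply, hPf]
    -- apply `T⁻¹`
    have h1 : ∑ z : ↥S, T⁻¹ x z * (u z.1 + K₁ u z.1) = Pf u x.1 := by
      calc ∑ z : ↥S, T⁻¹ x z * (u z.1 + K₁ u z.1)
          = ∑ z : ↥S, T⁻¹ x z * ∑ y : ↥S, T z y * Pf u y.1 := Finset.sum_congr rfl fun z _ => by rw [hrow z]
        _ = ∑ y : ↥S, (∑ z : ↥S, T⁻¹ x z * T z y) * Pf u y.1 := by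
            simp_rw [Finset.mul_sum]
            rw [Finset.sum_comm]
            refine Finset.sum_congr rfl fun y _ => ?_
            rw [Finset.sum_mul]
            refine Finset.sum_congr rfl fun z _ => ?_
            ring
        _ = ∑ y : ↥S, (T⁻¹ * T) x y * Pf u y.1 := Finset.sum_congr rfl fun y _ => by rw [Matrix.mul_apply]
        _ = Pf u x.1 := by
            rw [hTT]
            simp_rw [Matrix.one_apply, ite_mul, one_mul, zero_mul]
            rw [Finset.sum_ite_eq]; simp
    have hψx : ψ u x.1 = ∑ z : ↥S, T⁻¹ x z * u z.1 := by rw [hψ, dif_pos x.2]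
    have hψK : ψ (K₁ u) x.1 = ∑ z : ↥S, T⁻¹ x z * K₁ u z.1 := by rw [hψ, dif_pos x.2]
    rw [hψx, hψK, ← h1, ← Finset.sum_sub_distrib]
    refine Finset.sum_congr rfl fun z _ => ?_
    ring
  -- (v) the crude bound
  have hcrude : ∀ (x : ↥S) u N, 0 ≤ N → BW u N → |ψ u x.1| ≤ ((η ^ 2)⁻¹ * ∑ z : ↥S, |T⁻¹ x z|) * N := by
    intro x u N hN hu
    rw [hBW] at hu
    rw [hψ, dif_pos x.2, Finset.mul_sum, Finset.sum_mul]
    refine (Finset.abs_sum_le_sum_abs _ _).trans (Finset.sum_le_sum fun z _ => ?_)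
    rw [abs_mul]
    have hz0 : z.1 ∈ cube (ℓ + 1) a M ρ k 0 := by rw [← cubeFam_false_of_le (ℓ + 1) a M ρ (Nat.zero_le k)]; exact (hS z.1).mp z.2
    have hb := hu 0 (Nat.zero_le n) z.1 hz0
    rw [pow_zero, one_mul] at hb
    have hη2 : 0 < η ^ 2 := by positivity
    have : |u z.1| ≤ (η ^ 2)⁻¹ * N := by rw [le_inv_mul_iff₀ hη2]; exact hb
    calc |T⁻¹ x z| * |u z.1| ≤ |T⁻¹ x z| * ((η ^ 2)⁻¹ * N) := mul_le_mul_of_nonneg_left this (abs_nonneg _)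
      _ = (η ^ 2)⁻¹ * |T⁻¹ x z| * N := by ring
  -- (vi) the source `ρ′` extended by zero, of size `r`
  obtain ⟨u₀, hu₀⟩ : ∃ u₀ : (Fin (d + 1) → ℤ) → ℝ, ∀ z, u₀ z = if h : z ∈ S then ρ' ⟨z, h⟩ else 0 := ⟨_, fun _ => rfl⟩
  have hBWu₀ : BW u₀ r := by
    rw [hBW]
    intro j hj z hz
    have hzS : z ∈ S := hcubeS j hj z hz
    rw [hu₀, dif_pos hzS]
    have h := hρ' j hj ⟨z, hzS⟩ (by rw [cubeFam_false_of_le _ a M ρ (hj.trans hnk)]; exact hz)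
    simpa [wt] using h
  -- conclusion at `x₀`
  by_cases hx₀ : x₀ ∈ S
  · have hmain := apriori_functional_bound BW K₁ (fun u => ψ u x₀) (fun u => Pf u x₀) (C := C' + CW)
      (B₀ := (η ^ 2)⁻¹ * ∑ z : ↥S, |T⁻¹ ⟨x₀, hx₀⟩ z|) (by positivity)
      (fun u => hident u ⟨x₀, hx₀⟩) (fun u N hN hu => hPbound u N hN hu x₀) hKhalf (fun u N hN hu => hcrude ⟨x₀, hx₀⟩ u N hN hu)
      u₀ hr hBWu₀
    have hφψ : φ x₀ = ψ u₀ x₀ := by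
      rw [hφ ⟨x₀, hx₀⟩, hψ, dif_pos hx₀]
      refine Finset.sum_congr rfl fun z _ => ?_
      rw [hu₀, dif_pos z.2]
    rw [hφψ]
    simpa [mul_assoc] using hmain
  · rw [hφ0 x₀ (fun h => hx₀ ((hS x₀).mpr h)), abs_zero]
    positivity

end Literature.MathematicalPhysics.QuantumFieldTheory.Balaban1983to89.B8Eq1101CubeMemberReal
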